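import Summits.Parity.BatemanHorn.Theorems.SoloInformedWindowEquidistribution
import Summits.Parity.BatemanHorn.Theorems.SoloInformedHooleyLogSaving

/-!
# Located roots are equidistributed on GROWING windows `(x, x (log x)^α]` — unconditionally

[this work]  `SoloInformedWindowEquidistribution` proved, for `g ∈ ℤ[X]` irreducible of degree `≥ 2`,
that `|W_g(x; x, y) − Heur_g(x; x, y)| ≤ η x` for all large `x` and `x ≤ y ≤ T x`, at every FIXED `T`
(`W_g = polyWindowRootCount`, `Heur_g = polyWindowHeuristic`, Hooley 1964 used as `o(E)` per frequency).
Here the same block decomposition (Erdős–Turán per block of length `⌊x/m⌋ + 1`,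
`abs_polyWindowRootCount_sub_heuristic_le_erdosTuran`) is run with Hooley's bound in its QUANTITATIVE
frequency-uniform form `|∑_{E<e≤E'} S_g(h; e)| ≤ 2K √|h| E' (log E)^{−δ₁}` (`SoloInformedHooleyLogSaving`):

* `exists_abs_polyWindowRootCount_sub_heuristic_le_explicit` — the window bound with all parameters
  explicit: for `x ≥ x₁`, `T ≥ 1`, `m ≥ 2`, `H ≥ 1` and `x ≤ y ≤ T x`,
  `|W − Heur| ≤ K · (T x/m + T + T x/H + m T² H^{3/2} · x · (log x)^{−δ₁})`;
* `exists_abs_polyWindowRootCount_sub_heuristic_le_logPow` — **growing windows**: there is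
  `α = α(g) > 0` such that for every `η > 0`, all large `x` and all `x ≤ y ≤ (log x)^α · x`:
  `|W_g(x; x, y) − x (L_g(y) − L_g(x))| ≤ η x`
  (choose `T = ⌊(log x)^α⌋ + 1`, `m = H = M T`, `M ≈ K/η`, `α = min(δ₁/6, 1)`).

So the located roots of `g` are equidistributed not only on bounded windows past `x` but up to height
`x (log x)^{α}`; the window `(x (log x)^α, x^{d/2})` remains the open located-root problem
(`WindowRootEquidistribution`, equivalent to Erdős's asymptotic for `S_g`).  The count-currency corollaries
(`Mid_g(x) ≥ c x log log x`, `S_g(x) ≥ 2 A_g x log x + c x log log x` for `deg g ≥ 3`) are drawn in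
`SoloInformedLocatedRootLogLog`.
-/

noncomputable section

open Finset Polynomial Filter
open Literature.NumberTheory.Sieve (polyRootCountMod exists_sum_rootCount_le)
open Literature.Analysis.Fourier

namespace Summit.Parity.BatemanHorn.Theorems

/-! ## The window bound with explicit parameters -/

/-- **Explicit window bound.** [this work]  For `g` irreducible of degree `≥ 2` there are `δ₁ > 0`,
`K ≥ 0` and `x₁` such that for all `x ≥ x₁`, `T ≥ 1`, `m ≥ 2`, `H ≥ 1` and `x ≤ y ≤ T x`:
`|W_g(x; x, y) − Heur_g(x; x, y)| ≤ K (T x/m + T + T x/H + m T² H √H · x · (log x)^{−δ₁})`.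
(`m (T)` blocks of length `⌊x/m⌋ + 1`; per block Erdős–Turán with `H` frequencies and the uniform Hooley
bound with rate `exists_norm_sum_Ioc_hooleySum_le_logPow`; `∑_{e ≤ y} ρ_g(e) ≤ C y`.) -/
theorem exists_abs_polyWindowRootCount_sub_heuristic_le_explicit {g : ℤ[X]} (hirr : Irreducible g)
    (hdeg : 2 ≤ g.natDegree) :
    ∃ δ₁ : ℝ, 0 < δ₁ ∧ ∃ K : ℝ, 0 ≤ K ∧ ∃ x₁ : ℕ, ∀ x T m H : ℕ, x₁ ≤ x → 1 ≤ T → 2 ≤ m →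
      1 ≤ H → ∀ y : ℕ, x ≤ y → y ≤ T * x →
        |(polyWindowRootCount g x x y : ℝ) - polyWindowHeuristic g x x y|
          ≤ K * ((T : ℝ) * x / m + T + T * x / H
              + m * T * T * (H * Real.sqrt H) * x * Real.log x ^ (-δ₁)) := by
  classical
  have hg0 : ∀ x : ℕ, ∀ n ∈ Icc 1 x, g.eval (n : ℤ) ≠ 0 := fun x n _ =>
    eval_natCast_ne_zero_of_irreducible hirr hdeg n
  obtain ⟨C, hC0, hC⟩ := exists_sum_rootCount_le hirr (by omega)
  obtain ⟨δ₁, hδ₁, K₁, hK₁, x₀, hx₀⟩ := exists_norm_sum_Ioc_hooleySum_le_logPow hirr hdeg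
  set K : ℝ := max (802 * C) (3202 * K₁) with hKdef
  have hKC : 802 * C ≤ K := le_max_left _ _
  have hKK : 3202 * K₁ ≤ K := le_max_right _ _
  have hK0 : 0 ≤ K := le_trans (by positivity) hKC
  refine ⟨δ₁, hδ₁, K, hK0, max x₀ 2, fun x T m H hx hT hm2 hH1 y hxy hyT => ?_⟩
  have hx₀x : x₀ ≤ x := le_trans (le_max_left _ _) hx
  have hx2 : 2 ≤ x := le_trans (le_max_right _ _) hx
  have hxr : (0 : ℝ) < x := by exact_mod_cast (by omega : 0 < x)
  have hx2r : (2 : ℝ) ≤ x := by exact_mod_cast hx2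
  have hmr : (0 : ℝ) < m := by exact_mod_cast (by omega : 0 < m)
  have hHr : (0 : ℝ) < H := by exact_mod_cast hH1
  have hH1r : (1 : ℝ) ≤ H := by exact_mod_cast hH1
  have hTr : (1 : ℝ) ≤ T := by exact_mod_cast hT
  have hT0 : (0 : ℝ) ≤ T := by linarith
  have hlogx : 0 < Real.log x := Real.log_pos (by linarith)
  set L : ℝ := Real.log x ^ (-δ₁) with hLdef
  have hL0 : 0 ≤ L := Real.rpow_nonneg hlogx.le _
  have hyT₁ : ∀ y : ℕ, y ≤ T * x → (y : ℝ) ≤ T * x := fun y hy => by exact_mod_cast hy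
  -- block length `D = ⌊x/m⌋ + 1`
  obtain ⟨D, hDx, hmD, hDr⟩ : ∃ D : ℕ, D ≤ x ∧ x < m * D ∧ (D : ℝ) ≤ x / m + 1 := by
    refine ⟨x / m + 1, ?_, Nat.lt_mul_div_succ x (by omega), ?_⟩
    · have : x / m ≤ x / 2 := Nat.div_le_div_left hm2 (by norm_num)
      omega
    · have h : ((x / m : ℕ) : ℝ) ≤ (x : ℝ) / m := Nat.cast_div_le
      push_cast
      linarith
  have hDxr : (D : ℝ) / x ≤ 1 / m + 1 / x :=
    calc (D : ℝ) / x ≤ ((x : ℝ) / m + 1) / x := div_le_div_of_nonneg_right hDr hxr.le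
      _ = 1 / m + 1 / x := by rw [add_div, div_right_comm, div_self hxr.ne']
  -- total number of located points in `(x, y]`, `y ≤ T x`
  have hNle : ∀ y : ℕ, x ≤ y → y ≤ T * x →
      ∑ e ∈ Ioc x y, (polyRootCountMod ![g] e : ℝ) ≤ C * (T * x) := by
    intro y hxy hyT
    have hy2 : (2 : ℝ) ≤ y := by exact_mod_cast hx2.trans hxy
    calc ∑ e ∈ Ioc x y, (polyRootCountMod ![g] e : ℝ)
        ≤ ∑ e ∈ Icc 1 ⌊(y : ℝ)⌋₊, (polyRootCountMod ![g] e : ℝ) := by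
          rw [Nat.floor_natCast]
          exact sum_le_sum_of_subset_of_nonneg
            (fun e he => by rw [mem_Ioc] at he; rw [mem_Icc]; omega)
            fun _ _ _ => Nat.cast_nonneg _
      _ ≤ C * y := hC y hy2
      _ ≤ C * (T * x) := mul_le_mul_of_nonneg_left (hyT₁ y hyT) hC0.le
  -- the uniform Hooley bound on each block inside `(x, T x]`
  set B : ℝ := 2 * K₁ * Real.sqrt H * (T * x) * L with hBdef
  have hB0 : 0 ≤ B := by positivity
  have hHoo : ∀ y' y : ℕ, x ≤ y' → y' ≤ y → y ≤ 2 * y' → y ≤ T * x → ∀ d ∈ Icc 1 H,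
      ‖∑ e ∈ Ioc y' y, hooleySum g e d‖ ≤ B := by
    intro y' y hxy' hy'y _ hyT d hd
    have hd1 : 1 ≤ d := (mem_Icc.1 hd).1
    have hdH : d ≤ H := (mem_Icc.1 hd).2
    have hdne : (d : ℤ) ≠ 0 := by exact_mod_cast (by omega : d ≠ 0)
    have h := hx₀ y' y (hx₀x.trans hxy') hy'y (d : ℤ) hdne
    rw [Int.natAbs_natCast] at h
    have hsq : Real.sqrt (d : ℝ) ≤ Real.sqrt H := Real.sqrt_le_sqrt (by exact_mod_cast hdH)
    have hyr : (y : ℝ) ≤ T * x := hyT₁ y hyT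
    have hy'2 : (2 : ℝ) ≤ y' := by exact_mod_cast hx2.trans hxy'
    have hlogy' : Real.log x ≤ Real.log y' := Real.log_le_log hxr (by exact_mod_cast hxy')
    have hpow : Real.log y' ^ (-δ₁) ≤ L :=
      Real.rpow_le_rpow_of_nonpos hlogx hlogy' (by linarith)
    have hpow0 : 0 ≤ Real.log y' ^ (-δ₁) := Real.rpow_nonneg (by linarith) _
    refine h.trans ?_
    calc 2 * K₁ * Real.sqrt (d : ℝ) * y * Real.log y' ^ (-δ₁)
        ≤ 2 * K₁ * Real.sqrt H * (T * x) * Real.log y' ^ (-δ₁) := by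
          refine mul_le_mul_of_nonneg_right ?_ hpow0
          exact mul_le_mul (mul_le_mul_of_nonneg_left hsq (by positivity)) hyr
            (Nat.cast_nonneg y) (by positivity)
      _ ≤ B := mul_le_mul_of_nonneg_left hpow (by positivity)
  have hc : 2 / Real.pi + 1600 ≤ (1601 : ℝ) := by
    have := (div_le_one Real.pi_pos).2 Real.two_le_pi
    linarith
  -- induction over blocks of length `D`
  have key : ∀ k : ℕ, ∀ y : ℕ, x ≤ y → y ≤ x + k * D → y ≤ T * x →
      |(polyWindowRootCount g x x y : ℝ) - polyWindowHeuristic g x x y|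
        ≤ ((D : ℝ) / x + 1 / x + 802 / H) * ∑ e ∈ Ioc x y, (polyRootCountMod ![g] e : ℝ)
          + k * (1601 * H * B) := by
    intro k
    induction k with
    | zero =>
      intro y hxy hyk _
      have hyx : y = x := by omega
      rw [hyx, polyWindowRootCount_self, polyWindowHeuristic_self, Ioc_self, sum_empty]
      simp
    | succ k ih =>
      intro y hxy hyk hyT
      by_cases hcase : y ≤ x + k * D
      · refine (ih y hxy hcase hyT).trans ?_
        have hb : (0 : ℝ) ≤ 1601 * H * B := by positivity
        push_cast
        linarith
      · have hlt : x + k * D < y := not_le.1 hcase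
        have hxy' : x ≤ x + k * D := Nat.le_add_right _ _
        have hy'y : x + k * D ≤ y := hlt.le
        have hyD : y ≤ x + k * D + D := by
          have hsucc : (k + 1) * D = k * D + D := by ring
          omega
        have hy2 : y ≤ 2 * (x + k * D) := by omega
        have hyT' : x + k * D ≤ T * x := hy'y.trans hyT
        have hih := ih (x + k * D) hxy' le_rfl hyT'
        have hblock := abs_polyWindowRootCount_sub_heuristic_le_erdosTuran g (hg0 x) hx2 hxy'
          hy'y hy2 hH1
        -- the Hooley terms of the block
        have hsumH : ∑ d ∈ Icc 1 H, ‖∑ e ∈ Ioc (x + k * D) y, hooleySum g e d‖ / d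
            ≤ H * B := by
          calc ∑ d ∈ Icc 1 H, ‖∑ e ∈ Ioc (x + k * D) y, hooleySum g e d‖ / d
              ≤ ∑ d ∈ Icc 1 H, B := sum_le_sum fun d hd => by
                have hd1 : (1 : ℝ) ≤ d := by exact_mod_cast (mem_Icc.1 hd).1
                exact (div_le_self (norm_nonneg _) hd1).trans
                  (hHoo _ y hxy' hy'y hy2 hyT d hd)
            _ = H * B := by
                rw [sum_const, Nat.card_Icc, add_tsub_cancel_right, nsmul_eq_mul]
        have hHsum0 : (0 : ℝ) ≤ ∑ d ∈ Icc 1 H, ‖∑ e ∈ Ioc (x + k * D) y, hooleySum g e d‖ / d :=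
          sum_nonneg fun d _ => by positivity
        -- the arc-variation coefficient of the block
        have hy'r : (0 : ℝ) < ((x + k * D : ℕ) : ℝ) := by
          exact_mod_cast (by omega : 0 < x + k * D)
        have hyr : (0 : ℝ) < y := by exact_mod_cast (by omega : 0 < y)
        have hcoef : (x : ℝ) / ((x + k * D : ℕ) : ℝ) - x / y + 1 / ((x + k * D : ℕ) : ℝ)
            ≤ (D : ℝ) / x + 1 / x := by
          have hxley' : (x : ℝ) ≤ ((x + k * D : ℕ) : ℝ) := by exact_mod_cast hxy'
          have hyy' : (y : ℝ) ≤ ((x + k * D : ℕ) : ℝ) + D := by exact_mod_cast hyD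
          have hy'ley : ((x + k * D : ℕ) : ℝ) ≤ y := by exact_mod_cast hy'y
          have h1 : (x : ℝ) / ((x + k * D : ℕ) : ℝ) - x / y ≤ D / x := by
            rw [div_sub_div _ _ hy'r.ne' hyr.ne', div_le_div_iff₀ (mul_pos hy'r hyr) hxr]
            have hxx : (x : ℝ) * x ≤ ((x + k * D : ℕ) : ℝ) * y :=
              mul_le_mul hxley' (hxley'.trans hy'ley) hxr.le hy'r.le
            have t1 : (x : ℝ) * x * (y - ((x + k * D : ℕ) : ℝ)) ≤ x * x * D :=
              mul_le_mul_of_nonneg_left (by linarith) (mul_nonneg hxr.le hxr.le)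
            have t2 : (x : ℝ) * x * D ≤ ((x + k * D : ℕ) : ℝ) * y * D :=
              mul_le_mul_of_nonneg_right hxx (Nat.cast_nonneg D)
            linarith
          have h2 : (1 : ℝ) / ((x + k * D : ℕ) : ℝ) ≤ 1 / x :=
            div_le_div_of_nonneg_left zero_le_one hxr hxley'
          linarith
        have hN₂0 : (0 : ℝ) ≤ ∑ e ∈ Ioc (x + k * D) y, (polyRootCountMod ![g] e : ℝ) :=
          sum_nonneg fun e _ => Nat.cast_nonneg _
        have hstep : |(polyWindowRootCount g x (x + k * D) y : ℝ)
              - polyWindowHeuristic g x (x + k * D) y|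
            ≤ ((D : ℝ) / x + 1 / x + 802 / H) * ∑ e ∈ Ioc (x + k * D) y,
                (polyRootCountMod ![g] e : ℝ) + 1601 * H * B :=
          hblock.trans (by
            have h802 : 802 * (∑ e ∈ Ioc (x + k * D) y, (polyRootCountMod ![g] e : ℝ)) / H
                = 802 / (H : ℝ) * ∑ e ∈ Ioc (x + k * D) y, (polyRootCountMod ![g] e : ℝ) := by
              ring
            have hb' : (1601 : ℝ) * (H * B) = 1601 * H * B := by ring
            linarith [mul_le_mul_of_nonneg_right hcoef hN₂0, mul_le_mul hc hsumH hHsum0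
              (by norm_num), h802, hb'])
        rw [polyWindowRootCount_add g x hxy' hy'y, polyWindowHeuristic_add g x hxy' hy'y,
          ← sum_Ioc_consecutive _ hxy' hy'y]
        push_cast
        calc |((polyWindowRootCount g x x (x + k * D) : ℝ) + polyWindowRootCount g x (x + k * D) y)
              - (polyWindowHeuristic g x x (x + k * D) + polyWindowHeuristic g x (x + k * D) y)|
            = |((polyWindowRootCount g x x (x + k * D) : ℝ)
                  - polyWindowHeuristic g x x (x + k * D))
                + ((polyWindowRootCount g x (x + k * D) y : ℝ)
                  - polyWindowHeuristic g x (x + k * D) y)| := by congr 1; ring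
          _ ≤ |(polyWindowRootCount g x x (x + k * D) : ℝ) - polyWindowHeuristic g x x (x + k * D)|
              + |(polyWindowRootCount g x (x + k * D) y : ℝ)
                  - polyWindowHeuristic g x (x + k * D) y| := abs_add_le _ _
          _ ≤ _ := add_le_add hih hstep
          _ = _ := by push_cast; ring
  -- cover `(x, y]` by `m T` blocks and add up
  have hcover : y ≤ x + m * T * D := by
    have h2 : T * x ≤ m * T * D :=
      calc T * x ≤ T * (m * D) := Nat.mul_le_mul_left _ hmD.le
        _ = m * T * D := by ring
    omega
  refine (key (m * T) y hxy hcover hyT).trans ?_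
  have hN := hNle y hxy hyT
  have hN0 : (0 : ℝ) ≤ ∑ e ∈ Ioc x y, (polyRootCountMod ![g] e : ℝ) :=
    sum_nonneg fun e _ => Nat.cast_nonneg _
  have hmain : ((D : ℝ) / x + 1 / x + 802 / H) * ∑ e ∈ Ioc x y, (polyRootCountMod ![g] e : ℝ)
      ≤ (1 / m + 1 / x + 1 / x + 802 / H) * (C * (T * x)) :=
    mul_le_mul (by linarith) hN hN0 (by positivity)
  -- compare each piece with the `K`-form
  have hTxm0 : (0 : ℝ) ≤ (T : ℝ) * x / m := by positivity
  have hTxH0 : (0 : ℝ) ≤ (T : ℝ) * x / H := by positivity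
  have hW0 : (0 : ℝ) ≤ (m : ℝ) * T * T * (H * Real.sqrt H) * x * L := by positivity
  have hC1 : C ≤ K := by linarith
  have hC2 : 2 * C ≤ K := by linarith
  have e1 : 1 / (m : ℝ) * (C * (T * x)) = C * ((T : ℝ) * x / m) := by
    field_simp
  have e2 : 1 / (x : ℝ) * (C * (T * x)) = C * T := by
    field_simp
  have e3 : 802 / (H : ℝ) * (C * (T * x)) = 802 * C * ((T : ℝ) * x / H) := by
    field_simp
  have e4 : ((m * T : ℕ) : ℝ) * (1601 * H * B)
      = 3202 * K₁ * ((m : ℝ) * T * T * (H * Real.sqrt H) * x * L) := by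
    rw [hBdef]; push_cast; ring
  have i1 : C * ((T : ℝ) * x / m) ≤ K * ((T : ℝ) * x / m) := mul_le_mul_of_nonneg_right hC1 hTxm0
  have i2 : 2 * (C * (T : ℝ)) ≤ K * T := by nlinarith
  have i3 : 802 * C * ((T : ℝ) * x / H) ≤ K * ((T : ℝ) * x / H) :=
    mul_le_mul_of_nonneg_right hKC hTxH0
  have i4 : 3202 * K₁ * ((m : ℝ) * T * T * (H * Real.sqrt H) * x * L)
      ≤ K * ((m : ℝ) * T * T * (H * Real.sqrt H) * x * L) := mul_le_mul_of_nonneg_right hKK hW0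
  have hsplit : (1 / m + 1 / x + 1 / x + 802 / (H : ℝ)) * (C * (T * x))
      = 1 / (m : ℝ) * (C * (T * x)) + 1 / (x : ℝ) * (C * (T * x))
        + 1 / (x : ℝ) * (C * (T * x)) + 802 / (H : ℝ) * (C * (T * x)) := by ring
  rw [hsplit, e1, e2, e3] at hmain
  rw [e4]
  have htot : K * ((T : ℝ) * x / m + T + T * x / H + m * T * T * (H * Real.sqrt H) * x * L)
      = K * ((T : ℝ) * x / m) + K * T + K * ((T : ℝ) * x / H)
        + K * ((m : ℝ) * T * T * (H * Real.sqrt H) * x * L) := by ring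
  rw [htot]
  linarith

/-! ## Growing windows -/

/-- **Located roots are equidistributed on growing windows (unconditional).** [this work]
For `g` irreducible of degree `≥ 2` there is `α > 0` such that for every `η > 0` there is `x₀` with:
for all `x ≥ x₀` and all `y` with `x ≤ y ≤ (log x)^α · x`,
`|W_g(x; x, y) − x (L_g(y) − L_g(x))| ≤ η x`.
(`α = min(δ₁/6, 1)`; `T = ⌊(log x)^α⌋ + 1`, `m = H = M T` with `8K ≤ η M` in the explicit window
bound.) -/
theorem exists_abs_polyWindowRootCount_sub_heuristic_le_logPow {g : ℤ[X]} (hirr : Irreducible g)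
    (hdeg : 2 ≤ g.natDegree) :
    ∃ α : ℝ, 0 < α ∧ ∀ η : ℝ, 0 < η → ∃ x₀ : ℕ, ∀ x y : ℕ, x₀ ≤ x → x ≤ y →
      (y : ℝ) ≤ Real.log x ^ α * x →
        |(polyWindowRootCount g x x y : ℝ) - polyWindowHeuristic g x x y| ≤ η * x := by
  obtain ⟨δ₁, hδ₁, K, hK0, x₁, hx₁⟩ :=
    exists_abs_polyWindowRootCount_sub_heuristic_le_explicit hirr hdeg
  set α : ℝ := min (δ₁ / 6) 1 with hαdef
  have hα0 : 0 < α := lt_min (by positivity) one_pos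
  have hα6 : α ≤ δ₁ / 6 := min_le_left _ _
  have hα1 : α ≤ 1 := min_le_right _ _
  refine ⟨α, hα0, fun η hη => ?_⟩
  -- the constant `M` with `8 K ≤ η M`
  obtain ⟨M, hM2, hM⟩ : ∃ M : ℕ, 2 ≤ M ∧ 8 * K ≤ η * M := by
    refine ⟨⌈8 * K / η⌉₊ + 2, by omega, ?_⟩
    have h := Nat.le_ceil (8 * K / η)
    rw [div_le_iff₀ hη] at h
    push_cast
    nlinarith
  have hMr : (2 : ℝ) ≤ M := by exact_mod_cast hM2
  have hM0 : (0 : ℝ) < M := by linarith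
  -- basic limits in `x`
  have hL : Tendsto (fun x : ℕ => Real.log (x : ℝ)) atTop atTop :=
    Real.tendsto_log_atTop.comp tendsto_natCast_atTop_atTop
  have hev1 : ∀ᶠ x : ℕ in atTop, (1 : ℝ) ≤ Real.log x := hL.eventually_ge_atTop 1
  -- `2 K log x ≤ (η/4) x` eventually
  set c : ℝ := η / (8 * (K + 1)) with hcdef
  have hc0 : 0 < c := by positivity
  have hcK : 2 * K * c ≤ η / 4 := by
    have hK1 : (0 : ℝ) < K + 1 := by positivity
    calc 2 * K * c = η / 4 * (K / (K + 1)) := by rw [hcdef]; field_simp; ring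
      _ ≤ η / 4 * 1 := by
          refine mul_le_mul_of_nonneg_left ((div_le_one hK1).2 (by linarith)) (by positivity)
      _ = η / 4 := mul_one _
  have hev2 : ∀ᶠ x : ℕ in atTop, 2 * K * Real.log (x : ℝ) ≤ η / 4 * x := by
    filter_upwards [tendsto_natCast_atTop_atTop.eventually (Real.isLittleO_log_id_atTop.bound hc0),
      hev1] with x hx h1
    have hx0 : (0 : ℝ) ≤ x := Nat.cast_nonneg x
    have hl0 : (0 : ℝ) ≤ Real.log (x : ℝ) := by linarith
    rw [id_eq, Real.norm_of_nonneg hl0, Real.norm_of_nonneg hx0] at hx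
    calc 2 * K * Real.log (x : ℝ) ≤ 2 * K * (c * x) := mul_le_mul_of_nonneg_left hx (by positivity)
      _ = 2 * K * c * x := by ring
      _ ≤ η / 4 * x := mul_le_mul_of_nonneg_right hcK hx0
  -- `32 K M³ (log x)^{-α} ≤ η/4` eventually
  have hev3 : ∀ᶠ x : ℕ in atTop, 32 * K * (M : ℝ) ^ 3 * Real.log (x : ℝ) ^ (-α) ≤ η / 4 := by
    have h := ((tendsto_rpow_neg_atTop hα0).comp hL).const_mul (32 * K * (M : ℝ) ^ 3)
    rw [mul_zero] at h
    exact h.eventually (Iic_mem_nhds (by positivity))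
  have hev4 : ∀ᶠ x : ℕ in atTop, x₁ ≤ x := eventually_ge_atTop x₁
  obtain ⟨x₀, hx₀⟩ := eventually_atTop.1 (hev1.and (hev2.and (hev3.and hev4)))
  refine ⟨x₀, fun x y hx hxy hyL => ?_⟩
  obtain ⟨h1, h2, h3, h4⟩ := hx₀ x hx
  -- notation and the parameters at this `x`
  set Lx : ℝ := Real.log (x : ℝ) with hLxdef
  have hLx1 : 1 ≤ Lx := h1
  have hLx0 : 0 < Lx := by linarith
  have hxr : (0 : ℝ) < x := by
    have hx1 : (1 : ℝ) < x := by
      by_contra hle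
      rw [not_lt] at hle
      have : Lx ≤ 0 := Real.log_nonpos (Nat.cast_nonneg x) hle
      linarith
    linarith
  have hLα1 : 1 ≤ Lx ^ α := Real.one_le_rpow hLx1 hα0.le
  have hLαL : Lx ^ α ≤ Lx := by
    calc Lx ^ α ≤ Lx ^ (1 : ℝ) := Real.rpow_le_rpow_of_exponent_le hLx1 hα1
      _ = Lx := Real.rpow_one _
  set T : ℕ := ⌊Lx ^ α⌋₊ + 1 with hTdef
  have hT1 : 1 ≤ T := by omega
  have hTr : (T : ℝ) = ⌊Lx ^ α⌋₊ + 1 := by rw [hTdef]; push_cast; ring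
  have hLT : Lx ^ α ≤ T := by rw [hTr]; exact (Nat.lt_floor_add_one _).le
  have hT2 : (T : ℝ) ≤ 2 * Lx ^ α := by
    rw [hTr]
    have := Nat.floor_le (show 0 ≤ Lx ^ α by positivity)
    linarith
  have hT0 : (0 : ℝ) < T := by exact_mod_cast (by omega : 0 < T)
  have hT2L : (T : ℝ) ≤ 2 * Lx := by linarith
  have hyT : y ≤ T * x := by
    have : (y : ℝ) ≤ T * x := hyL.trans (mul_le_mul_of_nonneg_right hLT hxr.le)
    exact_mod_cast this
  have hm2 : 2 ≤ M * T := le_trans (by omega) (Nat.mul_le_mul hM2 hT1)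
  have hH1 : 1 ≤ M * T := le_trans (by norm_num) hm2
  have hMT1 : (1 : ℝ) ≤ (M : ℝ) * T := by exact_mod_cast hH1
  have hb := hx₁ x T (M * T) (M * T) h4 hT1 hm2 hH1 y hxy hyT
  push_cast at hb
  -- the four pieces
  have p1 : K * ((T : ℝ) * x / ((M : ℝ) * T)) ≤ η / 8 * x := by
    have e : (T : ℝ) * x / ((M : ℝ) * T) = x / M := by
      field_simp
    rw [e, show K * ((x : ℝ) / M) = K * x / M by ring, div_le_iff₀ hM0]
    nlinarith [mul_le_mul_of_nonneg_right hM hxr.le]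
  have p2 : K * (T : ℝ) ≤ η / 4 * x :=
    (mul_le_mul_of_nonneg_left hT2L hK0).trans (by linarith [h2])
  have p4 : K * ((M : ℝ) * T * T * T * ((M : ℝ) * T * Real.sqrt ((M : ℝ) * T)) * x * Lx ^ (-δ₁))
      ≤ η / 4 * x := by
    have hsq : Real.sqrt ((M : ℝ) * T) ≤ (M : ℝ) * T :=
      Real.sqrt_le_iff.2 ⟨by positivity, by nlinarith⟩
    have hpow0 : 0 ≤ Lx ^ (-δ₁) := Real.rpow_nonneg hLx0.le _
    have hT5 : (T : ℝ) ^ 5 ≤ 32 * Lx ^ (5 * α) := by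
      calc (T : ℝ) ^ 5 ≤ (2 * Lx ^ α) ^ 5 := pow_le_pow_left₀ hT0.le hT2 5
        _ = 32 * (Lx ^ α) ^ ((5 : ℕ) : ℝ) := by rw [Real.rpow_natCast]; ring
        _ = 32 * Lx ^ (5 * α) := by rw [← Real.rpow_mul hLx0.le]; ring_nf
    have hLL : Lx ^ (5 * α) * Lx ^ (-δ₁) ≤ Lx ^ (-α) := by
      rw [← Real.rpow_add hLx0]
      exact Real.rpow_le_rpow_of_exponent_le hLx1 (by linarith)
    calc K * ((M : ℝ) * T * T * T * ((M : ℝ) * T * Real.sqrt ((M : ℝ) * T)) * x * Lx ^ (-δ₁))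
        ≤ K * ((M : ℝ) * T * T * T * ((M : ℝ) * T * ((M : ℝ) * T)) * x * Lx ^ (-δ₁)) := by
          gcongr
      _ = K * (M : ℝ) ^ 3 * (T : ℝ) ^ 5 * (x * Lx ^ (-δ₁)) := by ring
      _ ≤ K * (M : ℝ) ^ 3 * (32 * Lx ^ (5 * α)) * (x * Lx ^ (-δ₁)) :=
          mul_le_mul_of_nonneg_right (mul_le_mul_of_nonneg_left hT5 (by positivity))
            (by positivity)
      _ = 32 * K * (M : ℝ) ^ 3 * (Lx ^ (5 * α) * Lx ^ (-δ₁)) * x := by ring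
      _ ≤ 32 * K * (M : ℝ) ^ 3 * Lx ^ (-α) * x :=
          mul_le_mul_of_nonneg_right (mul_le_mul_of_nonneg_left hLL (by positivity)) hxr.le
      _ ≤ η / 4 * x := mul_le_mul_of_nonneg_right h3 hxr.le
  have htot : K * ((T : ℝ) * x / ((M : ℝ) * T) + T + T * x / ((M : ℝ) * T)
      + (M : ℝ) * T * T * T * ((M : ℝ) * T * Real.sqrt ((M : ℝ) * T)) * x * Lx ^ (-δ₁))
      = K * ((T : ℝ) * x / ((M : ℝ) * T)) + K * T + K * ((T : ℝ) * x / ((M : ℝ) * T))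
        + K * ((M : ℝ) * T * T * T * ((M : ℝ) * T * Real.sqrt ((M : ℝ) * T)) * x * Lx ^ (-δ₁)) := by
    ring
  rw [htot] at hb
  linarith [hb, p1, p2, p4, mul_pos hη hxr]

end Summit.Parity.BatemanHorn.Theorems

end
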